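import Summits.QuantumFields.YangMills.Theorems.UnitScaleGibbsActionDerivativeSlotCalculus
import HarnessLib

/-!
# The second-order slot calculus of the Wilson plaquette word along `u` — THE DERIVATIVES:
# `X_u = actionDeriv` IS `∂_u A` (simultaneous flow), its one-bond rows `A′_b`, the one-bond rows `X′_b` of `X_u`, the sums `Σ_b A′_b = X_u`, `Σ_b X′_b = actionDeriv₂`, continuity

Sequel of `UnitScaleGibbsActionDerivativeSlotCalculus` (same seat `ym3-torus-px17` gen 7, same namespace; crux of record `UnitScaleTilt.HistoryTailL`
stmt-QuantumFields-19936, cell `ym3-torus` = YM ladder rung R3 — a RUNG, NOT the Clay problem), which defines the slots `slot ∕ slotIns ∕ slotIns₂`, the words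
`word ∕ word₂` and the four real observables `actionDeriv` (`X_u`), `oneBondDeriv b` (`A′_b`), `actionDeriv₂`, `oneBondDeriv₂ b` (`X′_b`) of the MATRIX MODEL
`ρ : G →* M_N(ℂ)`, `reTr = Re tr ρ ∕ N`, flows `ρ(k b t) = exp(t u_b)` (✓ `UnitScaleGibbsOneBondSchwingerDysonMatrix`, seat w8 g9).  THEOREMS ONLY (0 `def`, 0 `sorry`):

* §3 ★★ `hasDerivAt_wilsonAction4_flow` — along the SIMULTANEOUS flow `U ↦ (e ↦ k e t·U_e)`, `t ↦ A = wilsonAction4` has derivative `actionDeriv ρ u U` at `0`: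
  `X_u` IS `∂_u A`; ★★ `hasDerivAt_wilsonAction4_oneBond` — along `U ↦ U[b ↦ k b t·U_b]` the derivative is `oneBondDeriv ρ u b U` (the action rows `A′_b` of
  ✓ `integral_shiftDeriv_eq_gibbsMeasure`, in closed form); ★ `sum_oneBondDeriv : Σ_b A′_b = X_u`;
* §4 ★★ `hasDerivAt_actionDeriv_oneBond` — along `U ↦ U[b ↦ k b t·U_b]`, `t ↦ X_u` has derivative `oneBondDeriv₂ ρ u b U` (the rows `X′_b`; sixteen double-insertion
  words per plaquette); ★ `sum_oneBondDeriv₂ : Σ_b X′_b = actionDeriv₂ ρ u U` — the summed Hessian `∂_u∂_u A`;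
* §5 continuity in `U` of `X_u`, `A′_b`, `actionDeriv₂`, `X′_b` (continuous `ρ`, topological group `G`) — whence measurability and boundedness on the compact
  configuration space in the sequel `UnitScaleGibbsActionDerivativeGaussianDomination`, which also bounds `|actionDeriv₂| ≤ hessianBound u` and assembles Gross's
  Gaussian domination for `X_u`.

HONEST SCOPE.  Finite-dimensional calculus; nothing probabilistic; nothing of S_dom (sharp form), «ShallowFluxSecondMomentL», «BlockSecondMomentL», (Q), K1,
`MeanDeviationL`, `HistoryTailL`, R3, d = 4, a continuum limit or a mass gap is proved; LINE 28 («gross-sd-transfer») is an idea, not a line; the Yang–Mills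
mass gap is NOT proved.  `--supports stmt-QuantumFields-19936 --as helper`.

References: M. Creutz, Quarks, Gluons and Lattices (2022) Ch. 11 [Creutz2022]; S. Chatterjee, CMP 366 (2019) §8 [Chatterjee2019LargeN]; L. Gross, CMP 92 (1983) 137–162,
proof of Thm 2.2 [GrossCMP1983].
-/

set_option autoImplicit false

noncomputable section

open MeasureTheory Filter Topology NormedSpace
open scoped Matrix.Norms.Frobenius BigOperators
open Literature.MathematicalPhysics.QuantumFieldTheory.Balaban1983to89
open Summit.QuantumFields.YangMills.Theorems.UnitScaleGibbsOneBondSchwingerDyson (update_mul_zero update_mul_flow)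
open Summit.QuantumFields.YangMills.Cruxes.CurvatureAmnesia.WardDefect.SchwingerDyson (hasDerivAt_reTrace)

namespace Summit.QuantumFields.YangMills.Theorems.UnitScaleGibbsActionDerivativeSlotCalculus

/-! ## §3 The action along the simultaneous flow and along one bond; `Σ_b A′_b = X_u` -/

section Action

variable {N : ℕ} {P : Params} {j : ℕ} {G : Type} [GaugeGroup G]
  {ρ : G →* Matrix (Fin N) (Fin N) ℂ} {u : PBond P j → Matrix (Fin N) (Fin N) ℂ} {k : PBond P j → ℝ → G}

/-- ★★ **`X_u = actionDeriv` IS THE DERIVATIVE OF THE WILSON ACTION ALONG `u`**: along the simultaneous flow `U ↦ (e ↦ k e t·U_e)` (`ρ(k e t) = exp(t u_e)`),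
`t ↦ A` has derivative `actionDeriv ρ u U` at `t = 0` (matrix model `reTr = Re tr ρ ∕ N`). [cite: GrossCMP1983, Thm 2.2 (proof); Creutz2022, Ch. 11] -/
theorem hasDerivAt_wilsonAction4_flow (hre : ∀ g : G, reTr g = (ρ g).trace.re / N)
    (hk : ∀ b s t, k b (s + t) = k b s * k b t) (hkX : ∀ b t, ρ (k b t) = exp ((t : ℂ) • u b)) (U : GaugeField P j G) :
    HasDerivAt (fun t : ℝ => wilsonAction4 (fun e => k e t * U e)) (actionDeriv ρ u U) 0 := by
  have hfun : (fun t : ℝ => wilsonAction4 (fun e => k e t * U e)) = fun t : ℝ =>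
      ∑ p : Plaq P j, (1 : ℝ) * (1 - (word (slot ρ (fun e => k e t * U e) p)).trace.re / N) := by
    funext t
    unfold wilsonAction4 wilsonAction
    simp only [hre, rho_plaqHol_eq_word]
  rw [hfun]
  unfold actionDeriv
  refine HasDerivAt.fun_sum fun p _ => ?_
  have hw := hasDerivAt_word (S := fun t => slot ρ (fun e => k e t * U e) p) (D := slotIns ρ u U p)
    (fun i => hasDerivAt_slot_flow hk hkX U p i)
  have h0 : (slot ρ (fun e => k e 0 * U e) p) = slot ρ U p := by
    have : (fun e => k e 0 * U e) = U := funext fun e => by rw [flow_zero hk, one_mul]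
    rw [this]
  rw [h0] at hw
  have h := (((hasDerivAt_reTrace hw).div_const (N : ℝ)).const_sub (1 : ℝ)).const_mul (1 : ℝ)
  refine h.congr_deriv ?_
  rw [Matrix.trace_sum, Complex.re_sum, Finset.sum_div, one_mul, Finset.sum_neg_distrib]

variable [DecidableEq (PBond P j)]

/-- ★★ **THE ONE-BOND ROWS OF THE ACTION**: along `U ↦ U[b ↦ k b t·U_b]`, `t ↦ A` has derivative `A′_b = oneBondDeriv ρ u b U` at `t = 0` (only the slots carrying
`b` move). [cite: Creutz2022, Ch. 11; Chatterjee2019LargeN, §8] -/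
theorem hasDerivAt_wilsonAction4_oneBond (hre : ∀ g : G, reTr g = (ρ g).trace.re / N)
    (hk : ∀ b s t, k b (s + t) = k b s * k b t) (hkX : ∀ b t, ρ (k b t) = exp ((t : ℂ) • u b)) (b : PBond P j) (U : GaugeField P j G) :
    HasDerivAt (fun t : ℝ => wilsonAction4 (Function.update U b (k b t * U b))) (oneBondDeriv ρ u b U) 0 := by
  have hfun : (fun t : ℝ => wilsonAction4 (Function.update U b (k b t * U b))) = fun t : ℝ =>
      ∑ p : Plaq P j, (1 : ℝ) * (1 - (word (slot ρ (Function.update U b (k b t * U b)) p)).trace.re / N) := by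
    funext t
    unfold wilsonAction4 wilsonAction
    simp only [hre, rho_plaqHol_eq_word]
  rw [hfun]
  unfold oneBondDeriv
  refine HasDerivAt.fun_sum fun p _ => ?_
  have hw := hasDerivAt_word (S := fun t => slot ρ (Function.update U b (k b t * U b)) p)
    (D := fun i => if slotBond p i = b then slotIns ρ u U p i else 0) (fun i => hasDerivAt_slot_oneBond hk hkX b U p i)
  have h0 : slot ρ (Function.update U b (k b 0 * U b)) p = slot ρ U p := by rw [update_mul_zero (hk b) b U]
  rw [h0] at hw
  have h := (((hasDerivAt_reTrace hw).div_const (N : ℝ)).const_sub (1 : ℝ)).const_mul (1 : ℝ)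
  refine h.congr_deriv ?_
  rw [Matrix.trace_sum, Complex.re_sum, Finset.sum_div, one_mul, ← Finset.sum_neg_distrib]
  refine Finset.sum_congr rfl fun i _ => ?_
  split_ifs with hb
  · rfl
  · rw [word_update_zero]; simp

/-- ★ **`Σ_b A′_b = X_u`**: summing the one-bond rows over all bonds gives the action derivative along `u`. [cite: GrossCMP1983, Thm 2.2 (proof)] -/
theorem sum_oneBondDeriv (U : GaugeField P j G) : ∑ b, oneBondDeriv ρ u b U = actionDeriv ρ u U := by
  unfold oneBondDeriv actionDeriv
  rw [Finset.sum_comm]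
  refine Finset.sum_congr rfl fun p _ => ?_
  rw [Finset.sum_comm]
  refine Finset.sum_congr rfl fun i _ => ?_
  exact Finset.sum_ite_eq _ _ _ |>.trans (if_pos (Finset.mem_univ _))

end Action

/-! ## §4 The derivative of `X_u` along one bond; `Σ_b X′_b = actionDeriv₂` -/

section Second

variable {N : ℕ} {P : Params} {j : ℕ} [DecidableEq (PBond P j)] {G : Type} [GaugeGroup G]
  {ρ : G →* Matrix (Fin N) (Fin N) ℂ} {u : PBond P j → Matrix (Fin N) (Fin N) ℂ} {k : PBond P j → ℝ → G}

/-- The slots of the once-inserted word `slot[i ↦ slotIns i]` along the one-bond shift of `b`: slot `l ≠ i` moves iff its bond is `b` (first insertion),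
slot `i` moves iff its bond is `b` (second insertion). [cite: Creutz2022, Ch. 11] -/
theorem hasDerivAt_insSlot_oneBond (hk : ∀ b s t, k b (s + t) = k b s * k b t) (hkX : ∀ b t, ρ (k b t) = exp ((t : ℂ) • u b))
    (b : PBond P j) (U : GaugeField P j G) (p : Plaq P j) (i l : Fin 4) :
    HasDerivAt (fun t : ℝ => Function.update (slot ρ (Function.update U b (k b t * U b)) p) i
        (slotIns ρ u (Function.update U b (k b t * U b)) p i) l)
      (if slotBond p l = b then (if l = i then slotIns₂ ρ u U p i else slotIns ρ u U p l) else 0) 0 := by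
  by_cases hl : l = i
  · subst hl
    simp only [Function.update_self, if_true]
    exact hasDerivAt_slotIns_oneBond hk hkX b U p l
  · simp only [Function.update_of_ne hl, hl, if_false]
    exact hasDerivAt_slot_oneBond hk hkX b U p l

/-- ★★ **THE ONE-BOND ROWS OF `X_u`**: along `U ↦ U[b ↦ k b t·U_b]`, `t ↦ X_u = actionDeriv ρ u` has derivative `X′_b = oneBondDeriv₂ ρ u b U` at `t = 0`.
[cite: GrossCMP1983, Thm 2.2 (proof); Creutz2022, Ch. 11] -/
theorem hasDerivAt_actionDeriv_oneBond (hk : ∀ b s t, k b (s + t) = k b s * k b t) (hkX : ∀ b t, ρ (k b t) = exp ((t : ℂ) • u b))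
    (b : PBond P j) (U : GaugeField P j G) :
    HasDerivAt (fun t : ℝ => actionDeriv ρ u (Function.update U b (k b t * U b))) (oneBondDeriv₂ ρ u b U) 0 := by
  unfold actionDeriv oneBondDeriv₂
  refine HasDerivAt.fun_sum fun p _ => HasDerivAt.fun_sum fun i _ => ?_
  have hw := hasDerivAt_word
    (S := fun t => Function.update (slot ρ (Function.update U b (k b t * U b)) p) i (slotIns ρ u (Function.update U b (k b t * U b)) p i))
    (D := fun l => if slotBond p l = b then (if l = i then slotIns₂ ρ u U p i else slotIns ρ u U p l) else 0)
    (fun l => hasDerivAt_insSlot_oneBond hk hkX b U p i l)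
  have h0 : Function.update (slot ρ (Function.update U b (k b 0 * U b)) p) i (slotIns ρ u (Function.update U b (k b 0 * U b)) p i) =
      Function.update (slot ρ U p) i (slotIns ρ u U p i) := by rw [update_mul_zero (hk b) b U]
  rw [h0] at hw
  have h : HasDerivAt (fun t : ℝ => -((word (Function.update (slot ρ (Function.update U b (k b t * U b)) p) i
        (slotIns ρ u (Function.update U b (k b t * U b)) p i))).trace.re / (N : ℝ)))
      (-((∑ l, word (Function.update (Function.update (slot ρ U p) i (slotIns ρ u U p i)) l
        (if slotBond p l = b then (if l = i then slotIns₂ ρ u U p i else slotIns ρ u U p l) else 0))).trace.re / (N : ℝ))) 0 :=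
    ((hasDerivAt_reTrace hw).div_const (N : ℝ)).neg
  refine h.congr_deriv ?_
  rw [Matrix.trace_sum, Complex.re_sum, Finset.sum_div, ← Finset.sum_neg_distrib]
  refine Finset.sum_congr rfl fun l _ => ?_
  unfold word₂
  by_cases hb : slotBond p l = b
  · rw [if_pos hb, if_pos hb]
  · rw [if_neg hb, if_neg hb, word_update_zero]; simp

/-- ★ **`Σ_b X′_b = actionDeriv₂`**: the summed second derivative of the action along `u`. [cite: GrossCMP1983, Thm 2.2 (proof)] -/
theorem sum_oneBondDeriv₂ (U : GaugeField P j G) : ∑ b, oneBondDeriv₂ ρ u b U = actionDeriv₂ ρ u U := by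
  unfold oneBondDeriv₂ actionDeriv₂
  rw [Finset.sum_comm]
  refine Finset.sum_congr rfl fun p _ => ?_
  rw [Finset.sum_comm]
  refine Finset.sum_congr rfl fun i _ => ?_
  rw [Finset.sum_comm]
  refine Finset.sum_congr rfl fun l _ => ?_
  exact Finset.sum_ite_eq _ _ _ |>.trans (if_pos (Finset.mem_univ _))

end Second

/-! ## §5 Continuity in the configuration -/

section Continuity

variable {N : ℕ} {P : Params} {j : ℕ} {G : Type} [GaugeGroup G] [TopologicalSpace G] [IsTopologicalGroup G]
  {ρ : G →* Matrix (Fin N) (Fin N) ℂ} (hρ : Continuous ρ) (u : PBond P j → Matrix (Fin N) (Fin N) ℂ)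

include hρ

/-- Each slot is continuous in `U`. [folklore] -/
theorem continuous_slot (p : Plaq P j) (i : Fin 4) : Continuous fun U : GaugeField P j G => slot ρ U p i := by
  have hd : ∀ e : PBond P j, Continuous fun U : GaugeField P j G => ρ (U e) := fun e => hρ.comp (continuous_apply e)
  have hi : ∀ e : PBond P j, Continuous fun U : GaugeField P j G => ρ ((U e)⁻¹) := fun e => hρ.comp ((continuous_apply e).inv)
  fin_cases i
  · simpa [slot] using hd ⟨p.src, p.μ⟩
  · simpa [slot] using hd ⟨p.src.shift p.μ, p.ν⟩
  · simpa [slot] using hi ⟨p.src.shift p.ν, p.μ⟩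
  · simpa [slot] using hi ⟨p.src, p.ν⟩

/-- Each first insertion is continuous in `U`. [folklore] -/
theorem continuous_slotIns (p : Plaq P j) (i : Fin 4) : Continuous fun U : GaugeField P j G => slotIns ρ u U p i := by
  have hd : ∀ e : PBond P j, Continuous fun U : GaugeField P j G => u e * ρ (U e) :=
    fun e => continuous_const.mul (hρ.comp (continuous_apply e))
  have hi : ∀ e : PBond P j, Continuous fun U : GaugeField P j G => ρ ((U e)⁻¹) * (-u e) :=
    fun e => (hρ.comp ((continuous_apply e).inv)).mul continuous_const
  fin_cases i
  · simpa [slotIns] using hd ⟨p.src, p.μ⟩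
  · simpa [slotIns] using hd ⟨p.src.shift p.μ, p.ν⟩
  · simpa [slotIns] using hi ⟨p.src.shift p.ν, p.μ⟩
  · simpa [slotIns] using hi ⟨p.src, p.ν⟩

/-- Each second insertion is continuous in `U`. [folklore] -/
theorem continuous_slotIns₂ (p : Plaq P j) (i : Fin 4) : Continuous fun U : GaugeField P j G => slotIns₂ ρ u U p i := by
  have hd : ∀ e : PBond P j, Continuous fun U : GaugeField P j G => u e * (u e * ρ (U e)) :=
    fun e => continuous_const.mul (continuous_const.mul (hρ.comp (continuous_apply e)))
  have hi : ∀ e : PBond P j, Continuous fun U : GaugeField P j G => ρ ((U e)⁻¹) * (-u e) * (-u e) :=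
    fun e => ((hρ.comp ((continuous_apply e).inv)).mul continuous_const).mul continuous_const
  fin_cases i
  · simpa [slotIns₂] using hd ⟨p.src, p.μ⟩
  · simpa [slotIns₂] using hd ⟨p.src.shift p.μ, p.ν⟩
  · simpa [slotIns₂] using hi ⟨p.src.shift p.ν, p.μ⟩
  · simpa [slotIns₂] using hi ⟨p.src, p.ν⟩

omit [GaugeGroup G] [IsTopologicalGroup G] in
omit hρ in
/-- A word of slots depending continuously on `U` is continuous. [folklore] -/
theorem continuous_word_comp {S : GaugeField P j G → Fin 4 → Matrix (Fin N) (Fin N) ℂ} (hS : ∀ i, Continuous fun U => S U i) :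
    Continuous fun U => word (S U) :=
  (((hS 0).mul (hS 1)).mul (hS 2)).mul (hS 3)

/-- The once-inserted word is continuous in `U`. [folklore] -/
theorem continuous_word_ins (p : Plaq P j) (i : Fin 4) :
    Continuous fun U : GaugeField P j G => word (Function.update (slot ρ U p) i (slotIns ρ u U p i)) := by
  refine continuous_word_comp (S := fun U => Function.update (slot ρ U p) i (slotIns ρ u U p i)) fun l => ?_
  by_cases hl : l = i
  · subst hl; simp only [Function.update_self]; exact continuous_slotIns hρ u p l
  · simp only [Function.update_of_ne hl]; exact continuous_slot hρ p l

/-- The double-insertion words are continuous in `U`. [folklore] -/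
theorem continuous_word₂ (p : Plaq P j) (i l : Fin 4) : Continuous fun U : GaugeField P j G => word₂ ρ u U p i l := by
  unfold word₂
  refine continuous_word_comp
    (S := fun U => Function.update (Function.update (slot ρ U p) i (slotIns ρ u U p i)) l
      (if l = i then slotIns₂ ρ u U p i else slotIns ρ u U p l)) fun m => ?_
  by_cases hm : m = l
  · subst hm
    simp only [Function.update_self]
    split_ifs with h
    · exact continuous_slotIns₂ hρ u p i
    · exact continuous_slotIns hρ u p m
  · simp only [Function.update_of_ne hm]
    by_cases hmi : m = i
    · subst hmi; simp only [Function.update_self]; exact continuous_slotIns hρ u p m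
    · simp only [Function.update_of_ne hmi]; exact continuous_slot hρ p m

omit [GaugeGroup G] [IsTopologicalGroup G] in
omit hρ in
/-- `Re tr(·) ∕ N` of a continuous matrix family, negated, is continuous. [folklore] -/
theorem continuous_negReTrDiv {F : GaugeField P j G → Matrix (Fin N) (Fin N) ℂ} (hF : Continuous F) :
    Continuous fun U => -((F U).trace.re / N) :=
  ((Complex.continuous_re.comp hF.matrix_trace).div_const _).neg

/-- `X_u` is continuous in `U`. [folklore] -/
theorem continuous_actionDeriv : Continuous fun U : GaugeField P j G => actionDeriv ρ u U := by
  unfold actionDeriv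
  refine continuous_finsetSum _ fun p _ => continuous_finsetSum _ fun i _ => ?_
  exact continuous_negReTrDiv (continuous_word_ins hρ u p i)

/-- `actionDeriv₂` is continuous in `U`. [folklore] -/
theorem continuous_actionDeriv₂ : Continuous fun U : GaugeField P j G => actionDeriv₂ ρ u U := by
  unfold actionDeriv₂
  refine continuous_finsetSum _ fun p _ => continuous_finsetSum _ fun i _ => continuous_finsetSum _ fun l _ => ?_
  exact continuous_negReTrDiv (continuous_word₂ hρ u p i l)

variable [DecidableEq (PBond P j)]

/-- The one-bond rows `A′_b` are continuous in `U`. [folklore] -/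
theorem continuous_oneBondDeriv (b : PBond P j) : Continuous fun U : GaugeField P j G => oneBondDeriv ρ u b U := by
  unfold oneBondDeriv
  refine continuous_finsetSum _ fun p _ => continuous_finsetSum _ fun i _ => ?_
  split_ifs
  · exact continuous_negReTrDiv (continuous_word_ins hρ u p i)
  · exact continuous_const

/-- The one-bond rows `X′_b` are continuous in `U`. [folklore] -/
theorem continuous_oneBondDeriv₂ (b : PBond P j) : Continuous fun U : GaugeField P j G => oneBondDeriv₂ ρ u b U := by
  unfold oneBondDeriv₂
  refine continuous_finsetSum _ fun p _ => continuous_finsetSum _ fun i _ => continuous_finsetSum _ fun l _ => ?_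
  split_ifs
  · exact continuous_negReTrDiv (continuous_word₂ hρ u p i l)
  · exact continuous_const

end Continuity

end Summit.QuantumFields.YangMills.Theorems.UnitScaleGibbsActionDerivativeSlotCalculus

end
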